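import Literature.Algebra.Homology.DoubleComplexZigzag
import HarnessLib

/-!
# Staircases in an anticommuting double complex: the collating formula from the step relations

Complement to `DoubleComplexExactRows.lean` / `DoubleComplexZigzag.lean` (Weibel's acyclic assembly
`rowColEquiv : Hⁿ(A) ≃ Hⁿ(B)` for a row- and column-exact augmented first-quadrant double complex and
its zigzag formula `rowColEquiv_mk_eq_mk_of_totalD`).  A **staircase** of total degree `m` is a
homogeneous element `x = (x_{0,m}, x_{1,m-1}, …, x_{m,0})` whose consecutive entries are linked by
the STEP RELATIONS `δ x_{p,q+1} + d x_{p+1,q} = 0` (`p + q + 1 = m`); then all interior entries of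
`D x` vanish and

  `D x = (d x_{0,m} at (0, m+1)) + (δ x_{m,0} at (m+1, 0))`     (`totalD_eq_of_staircase`),

so the zigzag formula applies to the two ends of the staircase:
**`rowColEquiv [a] = [b]` whenever `ε a = d x_{0,m}` and `η b = -δ x_{m,0}`**
(`rowColEquiv_mk_eq_mk_of_staircase`).  This is the form in which an explicit descent
`ω ↦ h ω ↦ δ h ω ↦ h δ h ω ↦ …` of a closed invariant element down to a cocycle of the other
augmentation (Čech–de Rham: a closed form to the Čech cocycle of its iterated local primitives;
van Est: an invariant closed form to Dupont's cone cocycle) is fed to the comparison isomorphism.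
Pure algebra on the tree's concrete double complexes; theorems only.
[cite: BottTu1982Forms, Prop. 9.5] [cite: Weibel1994, Lemma 2.7.3 (proof)]

## References

* R. Bott, L. W. Tu, *Differential Forms in Algebraic Topology*, GTM 82 (1982), §8–9, Prop. 9.5
  (the collating formula). [BottTu1982Forms]
* C. A. Weibel, *An Introduction to Homological Algebra* (1994), Lemma 2.7.3. [Weibel1994]
-/

noncomputable section

open Function Literature.Algebra.Homology Literature.Algebra.Homology.ADoubleComplex

namespace Literature.Algebra.Homology

namespace ADoubleComplex

universe u w w' w''

variable {R : Type u} [CommRing R] {X : ℕ → ℕ → Type w} [∀ p q, AddCommGroup (X p q)]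
  [∀ p q, Module R (X p q)] {K : ADoubleComplex R X}
  {A : ℕ → Type w'} [∀ n, AddCommGroup (A n)] [∀ n, Module R (A n)]
  {B : ℕ → Type w''} [∀ n, AddCommGroup (B n)] [∀ n, Module R (B n)]

/-- A homogeneous family of total degree `m + 1` whose interior entries vanish is the sum of its two
corner entries `(0, m+1)` and `(m+1, 0)`. [folklore] -/
theorem eq_single_add_single_of_interior_eq_zero {m : ℕ} {z : ∀ p q, X p q} (hz : z ∈ Tn R (m + 1))
    (hint : ∀ p q, z (p + 1) (q + 1) = 0) :
    z = single 0 (m + 1) (z 0 (m + 1)) + single (m + 1) 0 (z (m + 1) 0) := by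
  funext p q
  rw [Pi.add_apply, Pi.add_apply]
  cases p with
  | zero =>
    cases q with
    | zero =>
      rw [hz 0 0 (by omega), single_apply_of_ne_snd (by omega), single_apply_of_ne_fst (by omega), add_zero]
    | succ q =>
      by_cases h : q = m
      · subst h
        rw [single_apply_same, single_apply_of_ne_fst (by omega), add_zero]
      · rw [hz 0 (q + 1) (by omega), single_apply_of_ne_snd (by omega), single_apply_of_ne_fst (by omega),
          add_zero]
  | succ p =>
    cases q with
    | zero =>
      by_cases h : p = m
      · subst h
        rw [single_apply_of_ne_fst (by omega), single_apply_same, zero_add]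
      · rw [hz (p + 1) 0 (by omega), single_apply_of_ne_fst (by omega), single_apply_of_ne_fst (by omega),
          add_zero]
    | succ q =>
      rw [hint p q, single_apply_of_ne_fst (by omega), single_apply_of_ne_snd (by omega), add_zero]

variable (K) in
/-- **The total differential of a staircase.**  If `x` is homogeneous of total degree `m` and its
consecutive entries satisfy the step relations `δ x_{p,q+1} + d x_{p+1,q} = 0` (`p + q + 1 = m`),
then `D x = (d x_{0,m} at (0, m+1)) + (δ x_{m,0} at (m+1, 0))`. [cite: BottTu1982Forms, Prop. 9.5] -/
theorem totalD_eq_of_staircase {m : ℕ} {x : ∀ p q, X p q} (hx : x ∈ Tn R m)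
    (hstep : ∀ p q, p + q + 1 = m → K.δ p (q + 1) (x p (q + 1)) + K.d (p + 1) q (x (p + 1) q) = 0) :
    K.totalD x = single 0 (m + 1) (K.d 0 m (x 0 m)) + single (m + 1) 0 (K.δ m 0 (x m 0)) := by
  have hint : ∀ p q, K.totalD x (p + 1) (q + 1) = 0 := by
    intro p q
    rw [totalD_apply_succ_succ]
    by_cases h : p + q + 1 = m
    · exact hstep p q h
    · rw [hx p (q + 1) (by omega), hx (p + 1) q (by omega), map_zero, map_zero, add_zero]
  have h := eq_single_add_single_of_interior_eq_zero (K.totalD_mem_Tn hx) hint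
  rw [totalD_apply_zero_succ, totalD_apply_succ_zero] at h
  exact h

/-- `single` is odd: `single p q (-v) = -single p q v` (local copy; the public lemma of this name
lives in `Literature/Geometry/Manifold/CechSmoothSingularDeRhamZigzag.lean`). [folklore] -/
private theorem single_neg' (p q : ℕ) (v : X p q) : single p q (-v) = -single p q v := by
  simp [single, Pi.single_neg]

/-- **The collating formula for a staircase.**  For a row- and column-exact double complex `K`
augmented by `A` (rows, `ε`) and `B` (columns, `η`), cocycles `a ∈ Zᵐ⁺¹(A)`, `b ∈ Zᵐ⁺¹(B)` and a
staircase `x` of total degree `m` (step relations `δ x_{p,q+1} + d x_{p+1,q} = 0`) with ends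
`ε a = d x_{0,m}` and `η b = -δ x_{m,0}`, the comparison isomorphism matches the classes:
`rowColEquiv [a] = [b]`. [cite: BottTu1982Forms, Prop. 9.5] [cite: Weibel1994, Lemma 2.7.3 (proof)] -/
theorem rowColEquiv_mk_eq_mk_of_staircase (E : K.RowAugmentation A) (E' : K.ColAugmentation B)
    (hK : K.RowExact) (hE : E.Exact) (hK' : K.ColExact) (hE' : E'.Exact) {m : ℕ}
    (a : ↥(NatCochain.cocycles E.dA (m + 1))) (b : ↥(NatCochain.cocycles E'.dA (m + 1)))
    (x : ∀ p q, X p q) (hx : x ∈ Tn R m)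
    (hstep : ∀ p q, p + q + 1 = m → K.δ p (q + 1) (x p (q + 1)) + K.d (p + 1) q (x (p + 1) q) = 0)
    (ha : E.ε (m + 1) a = K.d 0 m (x 0 m)) (hb : E'.ε (m + 1) b = -K.δ m 0 (x m 0)) :
    rowColEquiv E E' hK hE hK' hE' (m + 1) (NatCochain.Cohomology.mk E.dA (m + 1) a) =
      NatCochain.Cohomology.mk E'.dA (m + 1) b := by
  refine rowColEquiv_mk_eq_mk_of_totalD E E' hK hE hK' hE' a b x hx ?_
  rw [K.totalD_eq_of_staircase hx hstep, ha, hb, single_neg', sub_neg_eq_add]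

/-- **Injectivity read off a staircase.**  In the situation of `rowColEquiv_mk_eq_mk_of_staircase`,
if the end class `[b]` vanishes then so does `[a]`: `a` is a coboundary of the augmentation complex
`A` (e.g.: an invariant closed form whose Dupont cocycle is a coboundary is the differential of an
INVARIANT form of the same growth class). [cite: Weibel1994, Lemma 2.7.3] -/
theorem mk_eq_zero_of_staircase (E : K.RowAugmentation A) (E' : K.ColAugmentation B)
    (hK : K.RowExact) (hE : E.Exact) (hK' : K.ColExact) (hE' : E'.Exact) {m : ℕ}
    (a : ↥(NatCochain.cocycles E.dA (m + 1))) (b : ↥(NatCochain.cocycles E'.dA (m + 1)))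
    (x : ∀ p q, X p q) (hx : x ∈ Tn R m)
    (hstep : ∀ p q, p + q + 1 = m → K.δ p (q + 1) (x p (q + 1)) + K.d (p + 1) q (x (p + 1) q) = 0)
    (ha : E.ε (m + 1) a = K.d 0 m (x 0 m)) (hb : E'.ε (m + 1) b = -K.δ m 0 (x m 0))
    (hb0 : NatCochain.Cohomology.mk E'.dA (m + 1) b = 0) :
    NatCochain.Cohomology.mk E.dA (m + 1) a = 0 := by
  have h := rowColEquiv_mk_eq_mk_of_staircase E E' hK hE hK' hE' a b x hx hstep ha hb
  rw [hb0] at h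
  exact (LinearEquiv.map_eq_zero_iff _).1 h

end ADoubleComplex

end Literature.Algebra.Homology

end
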